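import Summits.QuantumAdvantage.QuantumAdvantage.Theses.CubicForrelation
import Summits.QuantumAdvantage.QuantumAdvantage.Theorems.CubicForrelationSignedExactCubicForrelationInPrBPPOfFinder
import HarnessLib

/-!
# Line `dual-pair-radical` — ALTERNATIVE skeleton for crux `SignedExactCubicForrelationNotPrBPP` (stmt-QuantumAdvantage-13932)

Strategist line (planner-cstrat-stmt-QuantumAdvantage-13932-s3-0, 2026-08-17), registered ALONGSIDE the live line
`Lines/classify_then_count.lean` (lead c4) and never touching it. Direction: REFUTATION (as every line of this crux): the
composition `SignedExactCubicForrelationInPrBPP_of` concludes the route's negation item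
`CubicForrelation.SignedExactCubicForrelationInPrBPP` (stmt-QuantumAdvantage-14671) BY NAME from crux r5
`ExactPairsMaioranaMcFarland` (route item, by name) and six registered stubs, through the LANDED reduction
`Theorems.SignedExactCubicForrelationInPrBPP.of_pairFinderMM` (item ⇐ one polynomial-time M-subspace finder on
Maiorana–McFarland-orbit exact cubic pairs + r5).

## The lever (new on this crux): the DUAL-PAIR OPERATOR ALGEBRA

Every registered line finds the hidden M-subspace `V_b` of the second function `b` of an exact cubic pair `(a,b)`
(`Φ(a,b) = ±1`, `a = ±` the dual of `b`) from ONE cubic tensor at a time (polar radicals, slice kernels, kernel statistics)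
or asserts that the residual objects do not exist (Conjecture BQ, `stub_bqClassification` of the live line). This line
uses the TWO cubic coefficient tensors `T_a`, `T_b` JOINTLY through the operators
`Π(x₀,y₀) : y ↦ T_a(x₀, T_b(y₀,y,·)♯, ·)` (`♯` = the dot-product identification; `piOp` below, eight-point third
differences of the two circuits, polynomial time). In hidden MM coordinates `b = y'·π(y'') ⊕ h(y'')`,
`a = x''·σ(x') ⊕ h(σ x') ⊕ c` (`σ = π⁻¹`, McFarland's dual, landed `stub_dualShape`) a direct computation gives the block
form `Π((p,v),(s,t)) = [[C, N], [0, A]]` w.r.t. `V_b = Y' ⊕ 0`, with `A = B_σ(p, B_π(t,·))`, `C = (B_π(t, B_σ(p,·)))ᵀ` — so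
`V_b` IS STABLE under the whole unital algebra `E = ⟨Π(X ⊗ Y)⟩ ⊆ End(𝔽₂ⁿ)` (`stub_flagStable`) — and, for `p = 0`, the
CANONICAL SQUARE-ZERO operators `N_{v,t} = (v·B_σ)(B_π(t,·), ·) : Y'' → Y'`, which are exactly what the third derivative
of the identity `σ ∘ π = id` produces: THIS is where "`σ` is quadratic too" (biquadraticity) enters at the identity level,
which no other line uses. Consequences on a CORE pair (`π` affine-free and translator-free — the residual objects of every
line): every `E`-submodule `U` with `U + V_b = Y` is `Y`, and every non-zero submodule meets `V_b` (images of the `N_{v,t}`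
span `V_b`, kernels cut out `V_b`), hence `V_b ⊆ Rad_E(Y)` = ⋂ maximal submodules (`stub_coreLower`, provable now); and
`Rad_E(Y) ⊆ V_b` iff the quotient module `Y/V_b ≅ (V, ⟨B_σ(p,B_π(t,·))⟩)` is semisimple (`stub_coreUpper`, the OPEN stub).
So on cores `V_b = Rad_E(Y) = J(E)·Y` is computable by linear algebra (Jacobson radical of a matrix algebra over `𝔽₂`:
Rónyai 1990, Cohen–Ivanyos–Wales 1997; Las-Vegas-free), and non-core pairs are peeled to cores along radical directions
(`stub_peel`, landed exact descent `Theorems…InPrBPPRadicalDescent.exact_quarter_pair`) — `stub_finder` assembles the FP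
function. Numerics (folder exp/, pure Python, exact lattice computations): disguised cube and cube² cores with generic
admissible `h`: `Rad_E(Y) = Soc_E(Y) = V_b` exactly (E of dimension 18 / 36); `Π(x₀,y₀) ∈ Der(T_b)` for 144/144 generator
pairs of a true dual pair vs 0/144 for a random cubic partner; `V_b` `E`-stable in every MM instance tried (Feistel, cube×id,
cube×Feistel, cube², all `h`); off-core the quotient algebra is often NOT semisimple (48/60 random biquadratic `π` of `𝔽₂⁴`,
all with affine components) — so `stub_coreUpper` is genuinely a statement about cores.

How it dodges the STUCK goal of the live line (`stub_bqClassification`: classify affine-free biquadratic permutations):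
nothing is classified and no statistics over unknown objects is claimed; the open stub is ONE algebraic property
(semisimplicity of the `B_σ∘B_π` algebra) of whatever cores exist — implied by BQ (cube^k: `E_A ≅ ⊕ M₃(𝔽₂)`), strictly
weaker-or-incomparable, and attackable by identities (`Σ_cyc B_σ(B_π(t,r), B_π(s,·)) = 0`, the cubic part of `σ∘π = id`).

Disproof.lean used: (a) sign transport / (a′) M-subspace duality are inside the landed readout this line reuses
(`of_pairFinderMM` ← `stub_plumbing` + `stub_signReadout`); no `_false_without_` theorem exists on this crux; the finder-zoo
heuristic "two generic seeds ⇒ E-closure = V" is REPLACED by a canonical object (no seeds, no genericity); near-miss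
`crux_false_sketch` (worst-case finder unproved) is exactly what `stub_coreUpper` + `stub_finder` would settle.
-/

set_option linter.dupNamespace false -- D-0017: single-problem summit ⇒ `QuantumAdvantage.QuantumAdvantage` by design

noncomputable section

namespace Summit.QuantumAdvantage.QuantumAdvantage.Cruxes.SignedExactCubicForrelationNotPrBPP.DualPairRadical

open Finset
open Literature.Computability.Complexity Literature.Computability.QuantumComplexity
open Literature.Computability.QuantumComplexity.BuzetChailloux (bxor zeroVec)
open Summit.QuantumAdvantage.QuantumAdvantage.Theses.CubicForrelation

/-! ## Vocabulary (finite linear algebra over `𝔽₂` on bit vectors; all instance-computable) -/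

variable {n : ℕ}

/-- `𝔽₂` dot product as a bit. -/
def bd (u v : Fin n → Bool) : Bool := ((univ.filter fun i => u i && v i).card).bodd

/-- The `i`-th unit vector. -/
def unitV (i : Fin n) : Fin n → Bool := fun j => decide (j = i)

/-- Third difference `D_u D_v D_w f (x)` (for `f` of degree `≤ 3` it does not depend on `x`: the cubic coefficient tensor
`T_f(u,v,w)`). -/
def d3 (f : (Fin n → Bool) → Bool) (u v w x : Fin n → Bool) : Bool :=
  (f x ^^ f (bxor x u) ^^ f (bxor x v) ^^ f (bxor x (bxor u v))) ^^
    (f (bxor x w) ^^ f (bxor (bxor x w) u) ^^ f (bxor (bxor x w) v) ^^ f (bxor (bxor x w) (bxor u v)))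

/-- Second difference `D_u D_v f (x)`. -/
def d2 (f : (Fin n → Bool) → Bool) (u v x : Fin n → Bool) : Bool :=
  f x ^^ f (bxor x u) ^^ f (bxor x v) ^^ f (bxor x (bxor u v))

/-- **The dual-pair operator** `Π_{a,b}(x₀,y₀) : y ↦ T_a(x₀, T_b(y₀,y,·)♯, ·)`: coordinate `j` of the image is
`⊕_i T_b(y₀,y,e_i) · T_a(x₀,e_i,e_j)` (third differences at `0`; `8 + 8` circuit evaluations per `(i,j)`). -/
def piOp (a b : (Fin n → Bool) → Bool) (x₀ y₀ y : Fin n → Bool) : Fin n → Bool :=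
  fun j => ((univ.filter fun i : Fin n => d3 b y₀ y (unitV i) zeroVec && d3 a x₀ (unitV i) (unitV j) zeroVec).card).bodd

/-- A linear subspace of `𝔽₂ⁿ` (as a finset of bit vectors). -/
def IsSub (U : Finset (Fin n → Bool)) : Prop := zeroVec ∈ U ∧ ∀ x ∈ U, ∀ y ∈ U, bxor x y ∈ U

/-- `U` is stable under every dual-pair operator, i.e. an `E`-submodule for `E = ⟨Π_{a,b}(x₀,y₀) : x₀, y₀⟩`. -/
def PiStable (a b : (Fin n → Bool) → Bool) (U : Finset (Fin n → Bool)) : Prop :=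
  ∀ x₀ y₀ : Fin n → Bool, ∀ y ∈ U, piOp a b x₀ y₀ y ∈ U

/-- A MAXIMAL proper `E`-submodule. -/
def MaxStable (a b : (Fin n → Bool) → Bool) (U : Finset (Fin n → Bool)) : Prop :=
  IsSub U ∧ PiStable a b U ∧ U ≠ univ ∧
    ∀ U' : Finset (Fin n → Bool), IsSub U' → PiStable a b U' → U ⊆ U' → U' ≠ univ → U' = U

/-- The MODULE RADICAL `Rad_E(𝔽₂ⁿ)` = intersection of the maximal proper `E`-submodules (= `J(E)·𝔽₂ⁿ`). -/
def moduleRad (a b : (Fin n → Bool) → Bool) : Finset (Fin n → Bool) :=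
  @Finset.filter (Fin n → Bool) (fun y => ∀ U, MaxStable a b U → y ∈ U) (Classical.decPred _) univ

/-- M-subspace of `f`: a subspace `V` with `|V|² = 2ⁿ` on whose cosets `f` is affine (all second differences along `V`
vanish) — verbatim the clause of `PairFinderMM`. -/
def MSub (f : (Fin n → Bool) → Bool) (V : Finset (Fin n → Bool)) : Prop :=
  (zeroVec ∈ V ∧ ∀ x ∈ V, ∀ y ∈ V, bxor x y ∈ V) ∧ ((V.card : ℝ) ^ 2 = (2 : ℝ) ^ n) ∧
    ∀ u ∈ V, ∀ v ∈ V, ∀ x, d2 f u v x = false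

variable {m : ℕ}

/-- Bilinear differential `B_π(v,w) = π(v⊕w) ⊕ π v ⊕ π w ⊕ π 0`. -/
def Bdiff (π : (Fin m → Bool) → (Fin m → Bool)) (v w : Fin m → Bool) : Fin m → Bool :=
  fun i => π (bxor v w) i ^^ π v i ^^ π w i ^^ π zeroVec i

/-- `π` has quadratic coordinate functions. -/
def QuadraticCoords (π : (Fin m → Bool) → (Fin m → Bool)) : Prop := ∀ i, IsDegLeFun 2 fun y => π y i

/-- NO AFFINE COMPONENT: every non-zero `u` sees a non-zero `u·B_π(v,w)`. -/
def AffineFree (π : (Fin m → Bool) → (Fin m → Bool)) : Prop :=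
  ∀ u : Fin m → Bool, u ≠ zeroVec → ∃ v w : Fin m → Bool, bd u (Bdiff π v w) = true

/-- NO TRANSLATOR (no affine direction): every non-zero `t` has a non-zero linear part `B_π(t,·)` of `D_t π`. -/
def TranslatorFree (π : (Fin m → Bool) → (Fin m → Bool)) : Prop :=
  ∀ t : Fin m → Bool, t ≠ zeroVec → ∃ y : Fin m → Bool, Bdiff π t y ≠ zeroVec

/-- A CORE permutation: affine-free and translator-free (both notions are symmetric in `π ↔ π⁻¹`). -/
def Core (π : (Fin m → Bool) → (Fin m → Bool)) : Prop := AffineFree π ∧ TranslatorFree π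

/-- Maiorana–McFarland shape `b(y',y'') = y'·π(y'') ⊕ h(y'')` (frame `Y' ⊕ 0 = {y'' = 0}`). -/
def IsMMShape (b : (Fin (m + m) → Bool) → Bool) (π : (Fin m → Bool) → (Fin m → Bool)) (h : (Fin m → Bool) → Bool) :
    Prop :=
  ∀ y' y'' : Fin m → Bool, b (Fin.append y' y'') = (bd y' (π y'') ^^ h y'')

/-- The TEMPLATE M-subspace `V_b = Y' ⊕ 0 = {y : y'' = 0}` of an MM-shaped `b`. -/
def frameV (m : ℕ) : Finset (Fin (m + m) → Bool) := univ.filter fun y => ∀ i : Fin m, y (Fin.natAdd m i) = false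

/-- An exact cubic TEMPLATE pair: `b` MM-shaped over a permutation `π` with quadratic coordinates and quadratic inverse,
both functions of degree `≤ 3`, `Φ(a,b) = ±1` (so `a = x''·π⁻¹(x') ⊕ h(π⁻¹ x') ⊕ [Φ = -1]`, landed `stub_dualShape`). -/
def TemplatePair (m : ℕ) (a b : (Fin (m + m) → Bool) → Bool) (π : (Fin m → Bool) ≃ (Fin m → Bool))
    (h : (Fin m → Bool) → Bool) : Prop :=
  IsMMShape b π h ∧ QuadraticCoords π ∧ QuadraticCoords π.symm ∧ IsDegLeFun 3 a ∧ IsDegLeFun 3 b ∧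
    (forrelation a b = 1 ∨ forrelation a b = -1)

/-- `b : 𝔽₂^{m+m} → 𝔽₂` lies on a completed Maiorana–McFarland orbit — VERBATIM the orbit clause of the landed
`Theorems.SignedExactCubicForrelationInPrBPP.of_pairFinderMM` / crux r5 (affine bijection `e`, permutation `perm`, `h`). -/
def MMOrbit (b : (Fin (m + m) → Bool) → Bool) : Prop :=
  ∃ e : (Fin (m + m) → Bool) ≃ (Fin (m + m) → Bool),
    (∃ M : Matrix (Fin (m + m)) (Fin (m + m)) (ZMod 2), ∃ c : Fin (m + m) → ZMod 2,
      ∀ y i, (if e y i then (1 : ZMod 2) else 0) = (M.mulVec (fun j => if y j then (1 : ZMod 2) else 0) + c) i) ∧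
    ∃ perm : (Fin m → Bool) ≃ (Fin m → Bool), ∃ h : (Fin m → Bool) → Bool, ∀ y' y'' : Fin m → Bool,
      (if b (e (Fin.append y' y'')) then (1 : ZMod 2) else 0) =
        (∑ i, (if y' i then (1 : ZMod 2) else 0) * (if perm y'' i then (1 : ZMod 2) else 0)) +
          (if h y'' then (1 : ZMod 2) else 0)

/-- The same orbit clause with the permutation a CORE one with quadratic coordinates both ways. -/
def CoreOrbit (b : (Fin (m + m) → Bool) → Bool) : Prop :=
  ∃ e : (Fin (m + m) → Bool) ≃ (Fin (m + m) → Bool),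
    (∃ M : Matrix (Fin (m + m)) (Fin (m + m)) (ZMod 2), ∃ c : Fin (m + m) → ZMod 2,
      ∀ y i, (if e y i then (1 : ZMod 2) else 0) = (M.mulVec (fun j => if y j then (1 : ZMod 2) else 0) + c) i) ∧
    ∃ perm : (Fin m → Bool) ≃ (Fin m → Bool), ∃ h : (Fin m → Bool) → Bool, (∀ y' y'' : Fin m → Bool,
      (if b (e (Fin.append y' y'')) then (1 : ZMod 2) else 0) =
        (∑ i, (if y' i then (1 : ZMod 2) else 0) * (if perm y'' i then (1 : ZMod 2) else 0)) +
          (if h y'' then (1 : ZMod 2) else 0)) ∧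
      QuadraticCoords perm ∧ QuadraticCoords perm.symm ∧ Core perm

/-- **The MM-orbit finder as a polynomial-time FUNCTION** — VERBATIM the first hypothesis of the landed
`Theorems.SignedExactCubicForrelationInPrBPP.of_pairFinderMM` (the live line's `PairFinderMM`). -/
abbrev PairFinderMM : Prop :=
  ∃ find ∈ FP, ∀ (m : ℕ) (C : Fin 2 → Circuit (Fin (m + m))),
      (⟨m + m, 2, C⟩ : KForrelationInstance).IsOverB2 →
      (∀ i, IsDegLeFun 3 (C i).eval) →
      (forrelation (C 0).eval (C 1).eval = 1 ∨ forrelation (C 0).eval (C 1).eval = -1) →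
      (∃ e : (Fin (m + m) → Bool) ≃ (Fin (m + m) → Bool),
        (∃ M : Matrix (Fin (m + m)) (Fin (m + m)) (ZMod 2), ∃ c : Fin (m + m) → ZMod 2,
          ∀ y i, (if e y i then (1 : ZMod 2) else 0) = (M.mulVec (fun j => if y j then (1 : ZMod 2) else 0) + c) i) ∧
        ∃ perm : (Fin m → Bool) ≃ (Fin m → Bool), ∃ h : (Fin m → Bool) → Bool, ∀ y' y'' : Fin m → Bool,
          (if (C 1).eval (e (Fin.append y' y'')) then (1 : ZMod 2) else 0) =
            (∑ i, (if y' i then (1 : ZMod 2) else 0) * (if perm y'' i then (1 : ZMod 2) else 0)) +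
              (if h y'' then (1 : ZMod 2) else 0)) →
      ∃ L : List (List Bool), find (KForrelationInstance.encode ⟨m + m, 2, C⟩) = encList L ∧
        ((zeroVec ∈ (@Finset.filter (Fin (m + m) → Bool) (fun v => (fun i => if v i then (1 : ZMod 2) else 0) ∈ F2Elim.rowSpan (m + m) L) (Classical.decPred _) Finset.univ) ∧ ∀ x ∈ (@Finset.filter (Fin (m + m) → Bool) (fun v => (fun i => if v i then (1 : ZMod 2) else 0) ∈ F2Elim.rowSpan (m + m) L) (Classical.decPred _) Finset.univ), ∀ y ∈ (@Finset.filter (Fin (m + m) → Bool) (fun v => (fun i => if v i then (1 : ZMod 2) else 0) ∈ F2Elim.rowSpan (m + m) L) (Classical.decPred _) Finset.univ), bxor x y ∈ (@Finset.filter (Fin (m + m) → Bool) (fun v => (fun i => if v i then (1 : ZMod 2) else 0) ∈ F2Elim.rowSpan (m + m) L) (Classical.decPred _) Finset.univ)) ∧ ((((@Finset.filter (Fin (m + m) → Bool) (fun v => (fun i => if v i then (1 : ZMod 2) else 0) ∈ F2Elim.rowSpan (m + m) L) (Classical.decPred _) Finset.univ)).card : ℝ) ^ 2 = (2 : ℝ)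 ^ (m + m)) ∧ (∀ u ∈ (@Finset.filter (Fin (m + m) → Bool) (fun v => (fun i => if v i then (1 : ZMod 2) else 0) ∈ F2Elim.rowSpan (m + m) L) (Classical.decPred _) Finset.univ), ∀ v ∈ (@Finset.filter (Fin (m + m) → Bool) (fun v => (fun i => if v i then (1 : ZMod 2) else 0) ∈ F2Elim.rowSpan (m + m) L) (Classical.decPred _) Finset.univ), ∀ x, ((C 1).eval x ^^ (C 1).eval (bxor x u) ^^ (C 1).eval (bxor x v) ^^ (C 1).eval (bxor x (bxor u v))) = false))

/-! ## The named statements of the line -/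

/-- (S1) **Flag stability.** For an exact cubic template pair, the template M-subspace `V_b = Y' ⊕ 0` is stable under every
dual-pair operator `Π_{a,b}(x₀,y₀)` (block form `[[C,N],[0,A]]`; ALL biquadratic `π`, ALL admissible `h`). -/
def FlagStable : Prop :=
  ∀ (m : ℕ) (a b : (Fin (m + m) → Bool) → Bool) (π : (Fin m → Bool) ≃ (Fin m → Bool)) (h : (Fin m → Bool) → Bool),
    TemplatePair m a b π h → PiStable a b (frameV m)

/-- (S2) **Core ⇒ `V_b ⊆ Rad`.** On a CORE template pair every maximal proper `E`-submodule contains `V_b` (a submodule `U`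
with `U + V_b = Y` contains all images of the canonical square-zero operators `N_{v,t} = Π((0,v),(·,t))`, which span `V_b`
when `π` is affine-free and `σ` translator-free). -/
def CoreLower : Prop :=
  ∀ (m : ℕ) (a b : (Fin (m + m) → Bool) → Bool) (π : (Fin m → Bool) ≃ (Fin m → Bool)) (h : (Fin m → Bool) → Bool),
    TemplatePair m a b π h → Core π → ∀ U : Finset (Fin (m + m) → Bool), MaxStable a b U → frameV m ⊆ U

/-- (S3, OPEN — the hardest stub) **Core ⇒ `Rad ⊆ V_b`**, i.e. the quotient module `Y/V_b ≅ (𝔽₂^m, ⟨B_σ(p, B_π(t,·))⟩_{p,t})`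
is SEMISIMPLE: every vector outside `V_b` is avoided by some maximal proper `E`-submodule. Implied by Conjecture BQ
(cube^k: the quotient algebra is `⊕ M₃(𝔽₂)`); genuinely about cores (fails for 48/60 random biquadratic `π` of `𝔽₂⁴`, all
with affine components). -/
def CoreUpper : Prop :=
  ∀ (m : ℕ) (a b : (Fin (m + m) → Bool) → Bool) (π : (Fin m → Bool) ≃ (Fin m → Bool)) (h : (Fin m → Bool) → Bool),
    TemplatePair m a b π h → Core π → ∀ y : Fin (m + m) → Bool, y ∉ frameV m → ∃ U, MaxStable a b U ∧ y ∉ U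

/-- (S4′) **Radical = M-subspace on core ORBITS** (what the finder consumes): for every exact cubic pair whose second function
lies on a CORE MM orbit, the module radical of the dual-pair algebra is an M-subspace of `b`. From S1–S3 by transport of
`Π` under the affine orbit map (`T_b ↦ T_b ∘ (M,M,M)`, `T_a ↦ T_a ∘ (M⁻ᵀ,M⁻ᵀ,M⁻ᵀ)` by exactness, `♯` contragredient ⇒ `Π`
conjugates by `M`), McFarland's dual shape for `a` (landed `stub_dualShape`), and `⋂ MaxStable = V_b` ⇒ `MSub`. -/
def RadicalCore : Prop :=
  ∀ (m : ℕ) (a b : (Fin (m + m) → Bool) → Bool), IsDegLeFun 3 a → IsDegLeFun 3 b →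
    (forrelation a b = 1 ∨ forrelation a b = -1) → CoreOrbit b → MSub b (moduleRad a b)

/-- (S4) **Peel dichotomy.** An exact cubic pair on an MM orbit either has a RADICAL DIRECTION (a non-zero `s` with
`T_b(s,·,·) = 0`, resp. `T_a(s,·,·) = 0` — then the landed exact descent `…InPrBPPRadicalDescent.exact_quarter_pair` drops
the dimension by two, keeping exactness, degrees and the sign) or its orbit permutation can be taken CORE. Content: an
affine component `u` of `perm` gives the radical direction `e(u,0)` of `b` (resp. of `a` for `perm⁻¹`); a TRANSLATOR of
`perm` forces an affine component (translator descent: `perm ≅ (perm̄, ε ⊕ γ∘perm̄)` and `γ ∈ Q₂(perm̄)`; m ≤ 5 census: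
every class with an affine direction has an affine component); quadratic coordinates of `perm`, `perm⁻¹` from degree `≤ 3`
of `b`, `a`. -/
def Peel : Prop :=
  ∀ (m : ℕ) (a b : (Fin (m + m) → Bool) → Bool), IsDegLeFun 3 a → IsDegLeFun 3 b →
    (forrelation a b = 1 ∨ forrelation a b = -1) → MMOrbit b →
    (∃ s : Fin (m + m) → Bool, s ≠ zeroVec ∧ ∀ v w x, d3 b s v w x = false) ∨
    (∃ s : Fin (m + m) → Bool, s ≠ zeroVec ∧ ∀ v w x, d3 a s v w x = false) ∨
    CoreOrbit b

/-! ## Registered stubs (the only `sorry`s) -/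

/-- stub (M, provable now): flag stability `FlagStable` — the block computation of `Π((p,v),(s,t))` in MM coordinates:
`T_b((s,t),(y',y''),(w',w'')) = y'·B_π(t,w'') ⊕ w'·B_π(t,y'') ⊕ β_{s}(y'',w'') ⊕ T_h(t,y'',w'')`, dual shape of `a`
(landed `Theorems.SignedExactCubicForrelationNotPrBPP.stub_dualShape`), and for `y = (y',0)`: `ξ = T_b(y₀,y,·)♯ = (0, B_π(t,·)ᵀy')`
has ZERO `X'`-part, so `T_a(x₀,ξ,·)♯` has zero `Y''`-part. [card §Stubs S1] -/
theorem stub_flagStable : FlagStable := by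
  sorry

/-- stub (M/L, provable now): `CoreLower` — canonical square-zero operators. Differentiating `σ(π(y)) = y` three times gives the
DERIVATION IDENTITY `T_σ(B_π(r,s), πr', πs') + (cyclic) = 0`, whence `Π((0,v),(·,t)) = N_{v,t} := (y',y'') ↦ ((v·B_σ)(B_π(t,y''),·)♯, 0)`;
`Σ_{v,t} im N_{v,t} = (Tr σ)^⊥ ⊕ 0 = V_b` (affine-free: `B_π(V,V)` spans; translator-free: `⋂_v rad(v·B_σ) = Tr σ = 0`), and a
submodule `U` with `U + V_b = Y` contains `N_{v,t}(U) = N_{v,t}(Y)`; a maximal proper `U ⊉ V_b` has `U + V_b = Y`. [card S2] -/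
theorem stub_coreLower : CoreLower := by
  sorry

/-- stub (OPEN, hardest): `CoreUpper` — semisimplicity of the quotient algebra `E_A = ⟨B_σ(p,B_π(t,·)) : p,t⟩` acting on `𝔽₂^m`
for CORE biquadratic `π`. Roads: (i) BQ ⇒ it (cube^k: `E_A = ⊕_blocks M₃(𝔽₂)`, checked exactly for k = 1, 2); (ii) directly from
the identities `A_{B(t,r),s} + A_{B(t,s),r} + A_{B(r,s),t} = 0` (cubic part of `σ∘π = id`) and its quadratic companion;
(iii) weakest sufficient form: `J(E_A)·V` is contained in the span of translators/affine data (vacuous on cores). Cheapest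
falsifier: ONE core `π` (any `m`) with `J(E_A) ≠ 0` — same unknown objects as BQ's, but ALSO refutable structurally. [card S3] -/
theorem stub_coreUpper : CoreUpper := by
  sorry

/-- stub (L, provable now — transport bookkeeping): S1 ∧ S2 ∧ S3 ⇒ `RadicalCore`. [card S4′] -/
theorem stub_transport : FlagStable → CoreLower → CoreUpper → RadicalCore := by
  sorry

/-- stub (M/L; one conjecture-grade clause = translator descent): `Peel`. [card S4] -/
theorem stub_peel : Peel := by
  sorry

/-- stub (XL, algorithmic; no new mathematics beyond cited algorithms): **the finder.** `find ∈ FP`: parse; REPEAT (≤ n/2 times):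
compute the cubic radicals of `b` and of `a` by row reduction of the `n × n²` third-difference matrices (`F2Elim`); if a radical
direction exists, pass to the explicit exact quarter pair of `exact_quarter_pair` (affine substitution into the SAME circuits;
r5 puts the quarter on an MM orbit again) and remember the lift; ELSE (core, by `Peel`) form the `n²` generator matrices
`Π(e_c,e_d)` (`piOp`), close under products to a basis of `E` (≤ n² rounds of row reduction), compute `J(E)` (Cohen–Ivanyos–Wales
/ Rónyai: iterated trace conditions in characteristic 2, polynomial time, deterministic) and output rows spanning `J(E)·𝔽₂ⁿ`
lifted back — an M-subspace by `RadicalCore` and M-subspace lifting along radical directions. FP by the tree's `CodeFP`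
combinators (`MSubspaceSignReadoutCodeFP`, `F2RowReduction`, `ForrelationCircuitCode`). [card S5; cite Ronyai1990, CIW1997] -/
theorem stub_finder : RadicalCore → Peel → ExactPairsMaioranaMcFarland → PairFinderMM := by
  sorry

/-! ## Composition: the line concludes the ROUTE'S negation item by name -/

/-- The MM-orbit finder from the stubs (r5 is used for the heredity of MM orbits under exact descent). -/
theorem pairFinderMM_of_stubs (h5 : ExactPairsMaioranaMcFarland) : PairFinderMM :=
  stub_finder (stub_transport stub_flagStable stub_coreLower stub_coreUpper) stub_peel h5

/-- **The line concludes `CubicForrelation.SignedExactCubicForrelationInPrBPP`** (item stmt-QuantumAdvantage-14671, the real route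
decl) from crux r5 (route item, by name): landed `of_pairFinderMM` (← `stub_plumbing` + `stub_signReadout`) fed with the
dual-pair-radical finder. THIS is the skeleton's deciding theorem. -/
theorem SignedExactCubicForrelationInPrBPP_of (h5 : ExactPairsMaioranaMcFarland) : SignedExactCubicForrelationInPrBPP :=
  Theorems.SignedExactCubicForrelationInPrBPP.of_pairFinderMM (pairFinderMM_of_stubs h5) h5

/-- … hence the crux is FALSE under the stubs and r5 (the crux BY NAME). -/
theorem SignedExactCubicForrelationNotPrBPP_false_of (h5 : ExactPairsMaioranaMcFarland) : ¬ SignedExactCubicForrelationNotPrBPP :=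
  fun h3 => h3 (SignedExactCubicForrelationInPrBPP_of h5)

/-- The same composition with every stub statement as a NAMED hypothesis (documentation of the dependency chain). -/
theorem signedExactInPrBPP_of_named (h1 : FlagStable) (h2 : CoreLower) (h3 : CoreUpper)
    (h4 : FlagStable → CoreLower → CoreUpper → RadicalCore) (h5p : Peel)
    (h6 : RadicalCore → Peel → ExactPairsMaioranaMcFarland → PairFinderMM)
    (h5 : ExactPairsMaioranaMcFarland) : SignedExactCubicForrelationInPrBPP :=
  Theorems.SignedExactCubicForrelationInPrBPP.of_pairFinderMM (h6 (h4 h1 h2 h3) h5p h5) h5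

/-! ## Sanity checks (sorry-free) -/

/-- The crux, by name, is non-membership of the tree's `signedExactCubicForrelationProblem 2`. -/
example : SignedExactCubicForrelationNotPrBPP = (signedExactCubicForrelationProblem 2 ∉ PromiseBPP') := rfl

/-- `frameV` is a subspace (template sanity). -/
example (m : ℕ) : zeroVec ∈ frameV m := by
  simp [frameV, zeroVec]

/-- The dual-pair operator is additive in `y` whenever the inner third difference is (it is a parity of a filter). Tiny
decidable instance (n = 2, `a = b = 0`): `Π ≡ 0`. -/
example : piOp (n := 2) (fun _ => false) (fun _ => false) zeroVec zeroVec zeroVec = zeroVec := by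
  funext j; simp [piOp, d3, zeroVec]

end Summit.QuantumAdvantage.QuantumAdvantage.Cruxes.SignedExactCubicForrelationNotPrBPP.DualPairRadical

end
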